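import Summits.BirchSwinnertonDyer.BirchSwinnertonDyer.Theorems.EisensteinPrimesMazurMCOnCellBTwistbackSubrowDatumOfKernelDisc
import HarnessLib

/-!
# Crux 3 `MazurMCOnCellB` (stmt-BirchSwinnertonDyer-19033), line `twistback` v5/v6 — the SKELETON'S sub-row datum from
# kernel-discriminant data, the three remaining discriminant types (`n*`, `−n*`, `−2n*`; part 8 of
# `…LocalBalanceAtUnramifiedPlace`, completing part 7's `D = 2n*`)

Width seat bsd-line-x2-p1-w7 (gen 2), cell `bsd-eis` (run/shared/lean/pub/bsd-eis/), 2026-08-28. HONEST FRAMING: UNCONDITIONAL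
kernel theorems (Dirichlet-character / Galois-module algebra over tree theorems: part 7's `exists_subrowDatum_of_kernelRadical`
and the radicals of w3 g8 / parts 4–5); no named fact, no reading; THEOREMS ONLY (no `def`, no `sorry`); `--supports`
stmt-BirchSwinnertonDyer-19033; closes no stub; nothing is booked; no summit statement, no Mazur main conjecture and no BSD is
proved for any curve; 0 cells / labels / stubs / tiers move.

WHY. With part 7 (`D = 2n*`) these three wrappers give, for EVERY squarefree kernel discriminant, a one-call adapter from a
per-pair certificate (rational `3`-line `Φ₀` with «`σ` fixes `Φ₀` iff `σ√D = √D`», finite `S₀ ⊇ A` with reduction types, ONE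
decidable identity) to THE EXISTENTIAL of the registered stub `stub_upperPartnerOffSubrow`'s excluded sub-row (token for
token the `hbal` of `upperPartner_at_three_of_balanceOne_of_{thmE,padicGZ}`, i.e. what v6's `upperPartner_onSubrow` consumes):
`exists_subrowDatum_of_kernelDisc_odd` (`D ≡ 1 (mod 4)`: indicator `J(ℓ | |D|)`, level `|D|`),
`exists_subrowDatum_of_kernelDisc_neg_star` (`D = −n*`: `χ₄(ℓ)J(ℓ | n)`, level `4n`),
`exists_subrowDatum_of_kernelDisc_neg_two_mul` (`D = −2n*`: `χ₈(ℓ)χ₄(ℓ)J(ℓ | n)`, level `8n`). The per-pair files of the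
sub-row cells (`…SubrowCell<label>`) are these adapters instantiated.

References: [GreenbergVatsal2000] §2 Prop. (2.4), p. 28, §3 p. 43; [Washington1997] Ch. 2–3; [IrelandRosen1990] Ch. 6 Prop.
6.3.2; [Cox2013] §1.C.
-/

set_option autoImplicit false
-- `Summit.BirchSwinnertonDyer.BirchSwinnertonDyer.…`: the summit and its single sub-problem share a name.
set_option linter.dupNamespace false

noncomputable section

open scoped Classical NumberTheorySymbols

open NumberField IsDedekindDomain Field WeierstrassCurve DirichletCharacter
  Literature.NumberTheory.EllipticCurves Literature.NumberTheory.GaloisRepresentations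
  Literature.NumberTheory.EllipticCurves.GreenbergVatsal2000
  Literature.NumberTheory.EllipticCurves.Rank1Residual Literature.NumberTheory.EllipticCurves.Rank1Residual.Typed
  Summit.BirchSwinnertonDyer.Rank1Residual Summit.BirchSwinnertonDyer.Rank1Residual.X2
  Summit.BirchSwinnertonDyer.Rank1Residual.Additive
  Summit.BirchSwinnertonDyer.BirchSwinnertonDyer.Theses
  Summit.BirchSwinnertonDyer.BirchSwinnertonDyer.Theorems.EisensteinPrimesMazurMCOnCellBTwistbackQuadraticRadical
  Summit.BirchSwinnertonDyer.BirchSwinnertonDyer.Theorems.EisensteinPrimesMazurMCOnCellBTwistbackSubrowKernelDiscEven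
  Summit.BirchSwinnertonDyer.BirchSwinnertonDyer.Theorems.EisensteinPrimesMazurMCOnCellBTwistbackSubrowKernelDiscNegTwo
  Summit.BirchSwinnertonDyer.BirchSwinnertonDyer.Theorems.EisensteinPrimesMazurMCOnCellBTwistbackSubrowDatumOfKernelDisc

namespace Summit.BirchSwinnertonDyer.BirchSwinnertonDyer.Theorems.EisensteinPrimesMazurMCOnCellBTwistbackSubrowDatumOfKernelDiscTypes

variable {W : WeierstrassCurve ℚ} [W.IsElliptic]

/-- **The skeleton's sub-row datum for an ODD kernel discriminant `D ≡ 1 (mod 4)`** (`|D|` squarefree; `D = 1` included;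
the A10 cells with `d_unr ∈ {5, 17, 29, 41, 65, 101}`): part 7 §1 over w3 g8's `exists_quadraticChar_geomSqrt_of_emod_four`
(`χ(a) = J(a | |D|)` modulo `|D|`). Unconditional. [cite: GreenbergVatsal2000, §2 Prop. (2.4) and §3 p. 43]
[cite: IrelandRosen1990, Ch. 6 Prop. 6.3.2] [cite: Cox2013, §1.C Lemma 1.14] -/
theorem exists_subrowDatum_of_kernelDisc_odd [W.IsGloballyMinimal]
    {Φ₀ : AddSubgroup (geomTorsion W (3 : ℤ))} (hΦ : IsRationalLine W 3 Φ₀)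
    {D : ℤ} (hD4 : D % 4 = 1) (hsq : Squarefree D.natAbs) [NeZero D.natAbs]
    (hker : ∀ σ : absoluteGaloisGroup ℚ,
      (∀ Q ∈ Φ₀, σ • Q = Q) ↔ σ • geomSqrt ((D : ℤ) : ℚ) = geomSqrt ((D : ℤ) : ℚ))
    (S₀ : Finset (HeightOneSpectrum (𝓞 ℚ))) (hS₀p : ∀ v ∈ S₀, ((3 : ℕ) : 𝓞 ℚ) ∉ v.asIdeal)
    (hS : ∀ v : HeightOneSpectrum (𝓞 ℚ), v ∉ S₀ → ((3 : ℕ) : 𝓞 ℚ) ∉ v.asIdeal → W.HasGoodReductionAt v)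
    (A : Finset (HeightOneSpectrum (𝓞 ℚ))) (hAS : A ⊆ S₀) (hA : ∀ v ∈ A, W.HasAdditiveReductionAt v)
    (hmult : ∀ v ∈ S₀, v ∉ A → W.HasMultiplicativeReductionAt v)
    (hbal : 1 = ∑ v ∈ S₀ \ A, (if W.HasSplitMultiplicativeReductionAt v
          then sFactor 3 (Rat.HeightOneSpectrum.natGenerator v) else 0) +
      ∑ v ∈ A, (if Rat.HeightOneSpectrum.natGenerator v ∣ D.natAbs then 0 else
        if Rat.HeightOneSpectrum.natGenerator v % 3 = 2 then sFactor 3 (Rat.HeightOneSpectrum.natGenerator v)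
        else 2 * (if J((Rat.HeightOneSpectrum.natGenerator v : ℤ) | D.natAbs) = 1
          then sFactor 3 (Rat.HeightOneSpectrum.natGenerator v) else 0))) :
    ∃ (Φ₀ : AddSubgroup (geomTorsion W (3 : ℤ))) (m : ℕ) (_ : NeZero m) (φ : DirichletCharacter (ZMod 3) m)
        (d : ℕ) (_ : NeZero d) (ψ : DirichletCharacter (ZMod 3) d) (S₀ : Finset (HeightOneSpectrum (𝓞 ℚ))),
      IsRationalLine W 3 Φ₀ ∧ φ.IsPrimitive ∧ ψ.IsPrimitive ∧
      (∀ (σ : absoluteGaloisGroup ℚ), ∀ P ∈ Φ₀,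
        σ • P = (φ ((modNCyclotomicCharacter ℚ m σ : (ZMod m)ˣ) : ZMod m)).val • P) ∧
      (∀ (σ : absoluteGaloisGroup ℚ) (P : geomTorsion W (3 : ℤ)),
        σ • P - (ψ ((modNCyclotomicCharacter ℚ d σ : (ZMod d)ˣ) : ZMod d)).val • P ∈ Φ₀) ∧
      (∀ v ∈ S₀, ((3 : ℕ) : 𝓞 ℚ) ∉ v.asIdeal) ∧
      (∀ v : HeightOneSpectrum (𝓞 ℚ), v ∉ S₀ → ((3 : ℕ) : 𝓞 ℚ) ∉ v.asIdeal → W.HasGoodReductionAt v) ∧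
      1 + ∑ v ∈ S₀, delta W 3 v =
        ∑ v ∈ S₀, ((if φ (Rat.HeightOneSpectrum.natGenerator v : ZMod m) =
              (Rat.HeightOneSpectrum.natGenerator v : ZMod 3)
            then sFactor 3 (Rat.HeightOneSpectrum.natGenerator v) else 0) +
          (if ψ (Rat.HeightOneSpectrum.natGenerator v : ZMod d) =
              (Rat.HeightOneSpectrum.natGenerator v : ZMod 3)
            then sFactor 3 (Rat.HeightOneSpectrum.natGenerator v) else 0)) := by
  haveI : Fact (Nat.Prime 3) := ⟨Nat.prime_three⟩
  obtain ⟨χ, hχ2, hprim, hval, hrad⟩ :=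
    EisensteinPrimesMazurMCOnCellBTwistbackQuadraticRadical.exists_quadraticChar_geomSqrt_of_emod_four (p := 3)
      (by decide) hD4 hsq
  have hD0 : ((D : ℤ) : ℚ) ≠ 0 := by
    have : D ≠ 0 := by rintro rfl; simp at hD4
    exact_mod_cast this
  refine EisensteinPrimesMazurMCOnCellBTwistbackSubrowDatumOfKernelDisc.exists_subrowDatum_of_kernelRadical hΦ χ hχ2 hprim
    (geomSqrt_ne_zero hD0) hrad hker S₀ hS₀p hS A hAS hA hmult ?_
  rw [hbal]
  congr 1
  refine Finset.sum_congr rfl fun v _ ↦ ?_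
  rw [hval]

/-- **The skeleton's sub-row datum for kernel discriminant `D = −n* ≡ 3 (mod 4)`** (`n` odd squarefree; the A10 cells with
`d_unr ∈ {11, 23}`): part 7 §1 over part 4's `exists_quadraticChar_geomSqrt_neg_star` (`χ₄·J` modulo `4n`). Unconditional.
[cite: GreenbergVatsal2000, §2 Prop. (2.4) and §3 p. 43] [cite: Washington1997, Ch. 3] -/
theorem exists_subrowDatum_of_kernelDisc_neg_star [W.IsGloballyMinimal]
    {Φ₀ : AddSubgroup (geomTorsion W (3 : ℤ))} (hΦ : IsRationalLine W 3 Φ₀)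
    {n : ℕ} [NeZero n] (hn : Odd n) (hsq : Squarefree n)
    (hker : ∀ σ : absoluteGaloisGroup ℚ,
      (∀ Q ∈ Φ₀, σ • Q = Q) ↔ σ • geomSqrt ((-((-1 : ℤ) ^ (n / 2) * n) : ℤ) : ℚ) = geomSqrt ((-((-1 : ℤ) ^ (n / 2) * n) : ℤ) : ℚ))
    (S₀ : Finset (HeightOneSpectrum (𝓞 ℚ))) (hS₀p : ∀ v ∈ S₀, ((3 : ℕ) : 𝓞 ℚ) ∉ v.asIdeal)
    (hS : ∀ v : HeightOneSpectrum (𝓞 ℚ), v ∉ S₀ → ((3 : ℕ) : 𝓞 ℚ) ∉ v.asIdeal → W.HasGoodReductionAt v)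
    (A : Finset (HeightOneSpectrum (𝓞 ℚ))) (hAS : A ⊆ S₀) (hA : ∀ v ∈ A, W.HasAdditiveReductionAt v)
    (hmult : ∀ v ∈ S₀, v ∉ A → W.HasMultiplicativeReductionAt v)
    (hbal : 1 = ∑ v ∈ S₀ \ A, (if W.HasSplitMultiplicativeReductionAt v
          then sFactor 3 (Rat.HeightOneSpectrum.natGenerator v) else 0) +
      ∑ v ∈ A, (if Rat.HeightOneSpectrum.natGenerator v ∣ 4 * n then 0 else
        if Rat.HeightOneSpectrum.natGenerator v % 3 = 2 then sFactor 3 (Rat.HeightOneSpectrum.natGenerator v)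
        else 2 * (if ZMod.χ₄ (Rat.HeightOneSpectrum.natGenerator v : ZMod 4) *
            J((Rat.HeightOneSpectrum.natGenerator v : ℤ) | n) = 1
          then sFactor 3 (Rat.HeightOneSpectrum.natGenerator v) else 0))) :
    ∃ (Φ₀ : AddSubgroup (geomTorsion W (3 : ℤ))) (m : ℕ) (_ : NeZero m) (φ : DirichletCharacter (ZMod 3) m)
        (d : ℕ) (_ : NeZero d) (ψ : DirichletCharacter (ZMod 3) d) (S₀ : Finset (HeightOneSpectrum (𝓞 ℚ))),
      IsRationalLine W 3 Φ₀ ∧ φ.IsPrimitive ∧ ψ.IsPrimitive ∧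
      (∀ (σ : absoluteGaloisGroup ℚ), ∀ P ∈ Φ₀,
        σ • P = (φ ((modNCyclotomicCharacter ℚ m σ : (ZMod m)ˣ) : ZMod m)).val • P) ∧
      (∀ (σ : absoluteGaloisGroup ℚ) (P : geomTorsion W (3 : ℤ)),
        σ • P - (ψ ((modNCyclotomicCharacter ℚ d σ : (ZMod d)ˣ) : ZMod d)).val • P ∈ Φ₀) ∧
      (∀ v ∈ S₀, ((3 : ℕ) : 𝓞 ℚ) ∉ v.asIdeal) ∧
      (∀ v : HeightOneSpectrum (𝓞 ℚ), v ∉ S₀ → ((3 : ℕ) : 𝓞 ℚ) ∉ v.asIdeal → W.HasGoodReductionAt v) ∧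
      1 + ∑ v ∈ S₀, delta W 3 v =
        ∑ v ∈ S₀, ((if φ (Rat.HeightOneSpectrum.natGenerator v : ZMod m) =
              (Rat.HeightOneSpectrum.natGenerator v : ZMod 3)
            then sFactor 3 (Rat.HeightOneSpectrum.natGenerator v) else 0) +
          (if ψ (Rat.HeightOneSpectrum.natGenerator v : ZMod d) =
              (Rat.HeightOneSpectrum.natGenerator v : ZMod 3)
            then sFactor 3 (Rat.HeightOneSpectrum.natGenerator v) else 0)) := by
  haveI : NeZero (4 * n) := ⟨mul_ne_zero (by norm_num) (NeZero.ne _)⟩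
  obtain ⟨χ, hχ2, hprim, hval, hrad⟩ :=
    EisensteinPrimesMazurMCOnCellBTwistbackSubrowKernelDiscEven.exists_quadraticChar_geomSqrt_neg_star hn hsq
  have hD0 : ((-((-1 : ℤ) ^ (n / 2) * n) : ℤ) : ℚ) ≠ 0 := by
    have hn0 : (n : ℤ) ≠ 0 := by exact_mod_cast NeZero.ne n
    have : (-((-1 : ℤ) ^ (n / 2) * n) : ℤ) ≠ 0 :=
      neg_ne_zero.mpr (mul_ne_zero (pow_ne_zero _ (by norm_num)) hn0)
    exact_mod_cast this
  refine EisensteinPrimesMazurMCOnCellBTwistbackSubrowDatumOfKernelDisc.exists_subrowDatum_of_kernelRadical hΦ χ hχ2 hprim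
    (geomSqrt_ne_zero hD0) hrad hker S₀ hS₀p hS A hAS hA hmult ?_
  rw [hbal]
  congr 1
  refine Finset.sum_congr rfl fun v _ ↦ ?_
  rw [hval]

/-- **The skeleton's sub-row datum for kernel discriminant `D = −2n*`** (`n` odd squarefree; the A10 cell `235200oj1`,
`D = 14`): part 7 §1 over part 5's `exists_quadraticChar_geomSqrt_neg_two_mul_star` (`χ₈χ₄·J` modulo `8n`). Unconditional.
[cite: GreenbergVatsal2000, §2 Prop. (2.4) and §3 p. 43] [cite: Washington1997, Ch. 2 and Ch. 3] -/
theorem exists_subrowDatum_of_kernelDisc_neg_two_mul [W.IsGloballyMinimal]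
    {Φ₀ : AddSubgroup (geomTorsion W (3 : ℤ))} (hΦ : IsRationalLine W 3 Φ₀)
    {n : ℕ} [NeZero n] (hn : Odd n) (hsq : Squarefree n)
    (hker : ∀ σ : absoluteGaloisGroup ℚ,
      (∀ Q ∈ Φ₀, σ • Q = Q) ↔ σ • geomSqrt ((-2 * ((-1 : ℤ) ^ (n / 2) * n) : ℤ) : ℚ) = geomSqrt ((-2 * ((-1 : ℤ) ^ (n / 2) * n) : ℤ) : ℚ))
    (S₀ : Finset (HeightOneSpectrum (𝓞 ℚ))) (hS₀p : ∀ v ∈ S₀, ((3 : ℕ) : 𝓞 ℚ) ∉ v.asIdeal)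
    (hS : ∀ v : HeightOneSpectrum (𝓞 ℚ), v ∉ S₀ → ((3 : ℕ) : 𝓞 ℚ) ∉ v.asIdeal → W.HasGoodReductionAt v)
    (A : Finset (HeightOneSpectrum (𝓞 ℚ))) (hAS : A ⊆ S₀) (hA : ∀ v ∈ A, W.HasAdditiveReductionAt v)
    (hmult : ∀ v ∈ S₀, v ∉ A → W.HasMultiplicativeReductionAt v)
    (hbal : 1 = ∑ v ∈ S₀ \ A, (if W.HasSplitMultiplicativeReductionAt v
          then sFactor 3 (Rat.HeightOneSpectrum.natGenerator v) else 0) +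
      ∑ v ∈ A, (if Rat.HeightOneSpectrum.natGenerator v ∣ 8 * n then 0 else
        if Rat.HeightOneSpectrum.natGenerator v % 3 = 2 then sFactor 3 (Rat.HeightOneSpectrum.natGenerator v)
        else 2 * (if ZMod.χ₈ (Rat.HeightOneSpectrum.natGenerator v : ZMod 8) *
            ZMod.χ₄ (Rat.HeightOneSpectrum.natGenerator v : ZMod 4) *
            J((Rat.HeightOneSpectrum.natGenerator v : ℤ) | n) = 1
          then sFactor 3 (Rat.HeightOneSpectrum.natGenerator v) else 0))) :
    ∃ (Φ₀ : AddSubgroup (geomTorsion W (3 : ℤ))) (m : ℕ) (_ : NeZero m) (φ : DirichletCharacter (ZMod 3) m)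
        (d : ℕ) (_ : NeZero d) (ψ : DirichletCharacter (ZMod 3) d) (S₀ : Finset (HeightOneSpectrum (𝓞 ℚ))),
      IsRationalLine W 3 Φ₀ ∧ φ.IsPrimitive ∧ ψ.IsPrimitive ∧
      (∀ (σ : absoluteGaloisGroup ℚ), ∀ P ∈ Φ₀,
        σ • P = (φ ((modNCyclotomicCharacter ℚ m σ : (ZMod m)ˣ) : ZMod m)).val • P) ∧
      (∀ (σ : absoluteGaloisGroup ℚ) (P : geomTorsion W (3 : ℤ)),
        σ • P - (ψ ((modNCyclotomicCharacter ℚ d σ : (ZMod d)ˣ) : ZMod d)).val • P ∈ Φ₀) ∧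
      (∀ v ∈ S₀, ((3 : ℕ) : 𝓞 ℚ) ∉ v.asIdeal) ∧
      (∀ v : HeightOneSpectrum (𝓞 ℚ), v ∉ S₀ → ((3 : ℕ) : 𝓞 ℚ) ∉ v.asIdeal → W.HasGoodReductionAt v) ∧
      1 + ∑ v ∈ S₀, delta W 3 v =
        ∑ v ∈ S₀, ((if φ (Rat.HeightOneSpectrum.natGenerator v : ZMod m) =
              (Rat.HeightOneSpectrum.natGenerator v : ZMod 3)
            then sFactor 3 (Rat.HeightOneSpectrum.natGenerator v) else 0) +
          (if ψ (Rat.HeightOneSpectrum.natGenerator v : ZMod d) =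
              (Rat.HeightOneSpectrum.natGenerator v : ZMod 3)
            then sFactor 3 (Rat.HeightOneSpectrum.natGenerator v) else 0)) := by
  haveI : NeZero (8 * n) := ⟨mul_ne_zero (by norm_num) (NeZero.ne _)⟩
  obtain ⟨χ, hχ2, hprim, hval, hrad⟩ :=
    EisensteinPrimesMazurMCOnCellBTwistbackSubrowKernelDiscNegTwo.exists_quadraticChar_geomSqrt_neg_two_mul_star hn hsq
  have hD0 : ((-2 * ((-1 : ℤ) ^ (n / 2) * n) : ℤ) : ℚ) ≠ 0 := by
    have hn0 : (n : ℤ) ≠ 0 := by exact_mod_cast NeZero.ne n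
    have : (-2 * ((-1 : ℤ) ^ (n / 2) * n) : ℤ) ≠ 0 :=
      mul_ne_zero (by norm_num) (mul_ne_zero (pow_ne_zero _ (by norm_num)) hn0)
    exact_mod_cast this
  refine EisensteinPrimesMazurMCOnCellBTwistbackSubrowDatumOfKernelDisc.exists_subrowDatum_of_kernelRadical hΦ χ hχ2 hprim
    (geomSqrt_ne_zero hD0) hrad hker S₀ hS₀p hS A hAS hA hmult ?_
  rw [hbal]
  congr 1
  refine Finset.sum_congr rfl fun v _ ↦ ?_
  rw [hval]

end Summit.BirchSwinnertonDyer.BirchSwinnertonDyer.Theorems.EisensteinPrimesMazurMCOnCellBTwistbackSubrowDatumOfKernelDiscTypes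

end
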